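import Literature.MathematicalPhysics.QuantumLattice.SparseKrausPerturbedStateShift
import Literature.MathematicalPhysics.QuantumLattice.HubbardFermionInteractionLocalHamiltonian
import HarnessLib

/-!
# The mean energy of the cell-averaged sparse Kraus perturbation

Topic `Literature/MathematicalPhysics/QuantumLattice`; namespace
`Literature.MathematicalPhysics.QuantumLattice` (the file path). Continuation of
`SparseKrausPerturbedState.lean` / `SparseKrausPerturbedStateShift.lean` (`KrausPattern`, `sparseState`,
`cellState`) in the vocabulary of `InfVolFermionState.lean` §6 (`FermionInteraction`, `meanEnergy`,
`localHamiltonian`). Everything is PROVED; no named fact.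

**Main result** (`KrausPattern.meanEnergy_cellState_eq`). Let `Φ` be an even, translation-invariant
interaction of finite range `R`, `ω` a translation-invariant (even) state, and `P = (Λ₀, V, a)` a Kraus
pattern whose spacing `a` exceeds the extent of `Λ₀` plus `⌊R⌋`. Then the translation-invariant cell
average `ω̄` of the sparse perturbations of `ω` has mean energy

  `e_Φ(ω̄) = e_Φ(ω) + a^{-d} · Re[ ω(𝓔(H_U)) − ω(H_U) ]`,   `U = (Λ₀)_{R,R}` (`thicken` twice),

where `𝓔(B) = Σ_k V_k⋆ B V_k` is the Kraus map placed at `Λ₀` and `H_U` the local Hamiltonian of `U`: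
perturbing at density `a^{-d}` changes the energy density by `a^{-d}` times the energy change of ONE
local perturbation. This is the energy bookkeeping of the variational argument for
"translation-invariant minimisers of the mean energy are ground states" (Ruelle 1969, Thm. 2 `2 ⇒`
positivity of the energy; Bratteli–Kishimoto–Robinson 1978, Thm. 2, `2 ⇒ 1`); the printed proofs go
through unique tangent functionals, here the finite-range structure is used directly:
only finitely many translates meet a region of diameter `≤ R`, at most ONE translate of each sparse
sublattice does, the classes `r ∈ (ℤ/aℤ)^d` partition all translates, and translation invariance of
`ω` and `Φ` reduces every contribution to the one at `Λ₀` (a double counting over rooted regions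
`(Z, y)`, `y ∈ Z`).

## References

* [Ruelle1969GroundState] D. Ruelle, Commun. Math. Phys. 11 (1969) 339–345, §2 eq. (4) (the mean energy
  `σ(A_Φ)`, `A_Φ = Σ_{X∋0} Φ(X)/N(X)`) and Thm. 2 (b).
* [BratteliKishimotoRobinson1978] Commun. Math. Phys. 64 (1978) 41–48, §3 and Thm. 2.
* [BratteliRobinsonII1997] OAQSM 2, §6.2.1 (finite-range interactions), §6.2.4 (mean energy).
-/

noncomputable section

namespace Literature.MathematicalPhysics.QuantumLattice

open Matrix Finset HubbardWave0 Literature.Probability.LatticeModels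
open scoped ComplexOrder

variable {d : ℕ}

/-! ### §1. Finite range, concretely -/

/-- **Finite range, concretely**: a region carrying a nonzero term of an interaction of range `R` lies in
the sup-norm ball of radius `⌊R⌋` around each of its points (fermionic twin of the tree's
`LatticeInteraction.HasFiniteRange.subset_image_box`). [cite: BratteliRobinsonII1997, §6.2.1 (finite range)] -/
theorem FermionInteraction.HasFiniteRange.subset_image_box {Ψ : FermionInteraction d} {R : ℝ}
    (hR : Ψ.HasFiniteRange R) {X : Finset (Site d)} (hX : Ψ.Φ X ≠ 0) {x : Site d} (hx : x ∈ X) :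
    X ⊆ (box d ⌊R⌋₊).image (fun w => x + w) := by
  have hdiam : Metric.diam (X : Set (Site d)) ≤ R := le_of_not_gt fun h => hX (hR X h)
  intro y hy
  have hxy : dist y x ≤ R :=
    (Metric.dist_le_diam_of_mem X.finite_toSet.isBounded hy hx).trans hdiam
  have hR0 : 0 ≤ R := dist_nonneg.trans hxy
  refine mem_image.2 ⟨y - x, ?_, add_sub_cancel x y⟩
  rw [mem_box]
  intro i
  have hi : dist (y i) (x i) ≤ R := (dist_le_pi_dist y x i).trans hxy
  rw [Int.dist_eq] at hi
  have hk : |y i - x i| ≤ (⌊R⌋₊ : ℤ) := by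
    rw [Int.natCast_floor_eq_floor hR0, Int.le_floor]
    push_cast
    exact hi
  rw [abs_le] at hk
  rw [Pi.sub_apply]
  exact hk

/-- Coordinates of two points of a region carrying a nonzero term differ by at most `⌊R⌋`.
[cite: BratteliRobinsonII1997, §6.2.1 (finite range)] -/
theorem FermionInteraction.HasFiniteRange.sub_le_floor {Ψ : FermionInteraction d} {R : ℝ}
    (hR : Ψ.HasFiniteRange R) {X : Finset (Site d)} (hX : Ψ.Φ X ≠ 0) {p p' : Site d} (hp : p ∈ X)
    (hp' : p' ∈ X) (i : Fin d) : p i - p' i ≤ ⌊R⌋₊ := by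
  obtain ⟨w, hw, rfl⟩ := mem_image.1 (hR.subset_image_box hX hp' hp)
  rw [mem_box] at hw
  rw [Pi.add_apply, add_sub_cancel_left]
  exact (hw i).2

/-- Membership in an `R`-neighbourhood: `z ∈ thicken S R ↔ z = s + w`, `s ∈ S`, `w ∈ box ⌊R⌋`.
[cite: BratteliRobinsonII1997, §6.2.1] -/
theorem mem_thicken_iff {S : Finset (Site d)} {R : ℝ} {z : Site d} :
    z ∈ thicken S R ↔ ∃ s ∈ S, ∃ w ∈ box d ⌊R⌋₊, s + w = z := by
  simp only [thicken, Finset.mem_biUnion, Finset.mem_image]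

/-- A translate `Z - y` of a region carrying a nonzero term by one of its points lies in the
`R`-neighbourhood of the origin. [cite: BratteliRobinsonII1997, §6.2.1 (finite range)] -/
theorem FermionInteraction.HasFiniteRange.shiftSet_neg_subset_thicken_zero {Ψ : FermionInteraction d}
    {R : ℝ} (hR : Ψ.HasFiniteRange R) {Z : Finset (Site d)} (hZ : Ψ.Φ Z ≠ 0) {y : Site d} (hy : y ∈ Z) :
    shiftSet (-y) Z ⊆ thicken ({0} : Finset (Site d)) R := by
  intro z hz
  rw [mem_shiftSet, sub_neg_eq_add] at hz
  obtain ⟨w, hw, hzw⟩ := mem_image.1 (hR.subset_image_box hZ hy hz)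
  rw [mem_thicken_iff]
  refine ⟨0, Finset.mem_singleton_self _, w, hw, ?_⟩
  rw [zero_add]
  have := congrArg (fun t => t - y) hzw
  simpa using this

namespace KrausPattern

variable (P : KrausPattern d)

/-! ### §2. All translates meeting a region, and the sparse classes -/

/-- **All translates of `Λ₀` meeting `X`**: `{x : (x + Λ₀) ∩ X ≠ ∅} = {p - q : p ∈ X, q ∈ Λ₀}`.
[cite: BratteliKishimotoRobinson1978, Thm. 2 (proof: the regions meeting Λ)] -/
def allTouch (X : Finset (Site d)) : Finset (Site d) := (X ×ˢ P.Λ₀).image fun p => p.1 - p.2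

/-- Membership in `allTouch`. [cite: BratteliKishimotoRobinson1978, Thm. 2 (proof)] -/
theorem mem_allTouch {X : Finset (Site d)} {x : Site d} : x ∈ P.allTouch X ↔ ∃ y ∈ P.Λ₀, y + x ∈ X := by
  unfold allTouch
  rw [Finset.mem_image]
  constructor
  · rintro ⟨p, hp, rfl⟩
    rw [Finset.mem_product] at hp
    exact ⟨p.2, hp.2, by rw [add_sub_cancel]; exact hp.1⟩
  · rintro ⟨y, hy, hyx⟩
    exact ⟨(y + x, y), Finset.mem_product.2 ⟨hyx, hy⟩, by simp⟩

/-- The sparse translates meeting `X` are the translates meeting `X` of the class `r`.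
[cite: BratteliKishimotoRobinson1978, Thm. 2 (proof)] -/
theorem mem_touch_iff_mem_allTouch {r : Fin d → ZMod P.a} {X : Finset (Site d)} {x : Site d} :
    x ∈ P.touch r X ↔ x ∈ P.allTouch X ∧ P.IsSparse r x := by
  rw [mem_touch, mem_allTouch, and_comm]

/-- `x ≡ r` iff `r` is the residue class of `x`. [cite: Ruelle1969GroundState, §2 (lattice translations)] -/
theorem isSparse_iff_eq_residue {r : Fin d → ZMod P.a} {x : Site d} : P.IsSparse r x ↔ r = P.residue x := by
  constructor
  · intro h; funext i; exact (h i).symm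
  · rintro rfl i; rfl

/-- **The residue classes partition the translates**: summing a function over the sparse translates of
each class and then over all classes `r ∈ (ℤ/aℤ)^d` is summing it over all translates meeting `X`.
[cite: Ruelle1969GroundState, §2 (the lattice ℤ^ν and its sublattices)] -/
theorem sum_sum_touch_eq_sum_allTouch [NeZero P.a] {M : Type*} [AddCommMonoid M] (X : Finset (Site d))
    (g : Site d → M) :
    ∑ r : Fin d → ZMod P.a, ∑ x ∈ P.touch r X, g x = ∑ x ∈ P.allTouch X, g x := by
  classical
  have h : ∀ r : Fin d → ZMod P.a, ∑ x ∈ P.touch r X, g x =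
      ∑ x ∈ P.allTouch X, if r = P.residue x then g x else 0 := by
    intro r
    rw [← Finset.sum_filter]
    refine Finset.sum_congr ?_ fun _ _ => rfl
    ext x
    rw [mem_touch_iff_mem_allTouch, Finset.mem_filter, isSparse_iff_eq_residue]
  simp_rw [h]
  rw [Finset.sum_comm]
  refine Finset.sum_congr rfl fun x _ => ?_
  rw [Finset.sum_ite_eq' Finset.univ (P.residue x) (fun _ => g x)]
  simp

/-- **At most one translate of each sparse class meets a region of range `≤ ⌊R⌋`** when the spacing `a`
exceeds the extent of `Λ₀` plus `⌊R⌋`. [cite: BratteliRobinsonII1997, §6.2.1 (finite range)] -/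
theorem touch_subsingleton {R : ℝ} (hsp : ∀ y ∈ P.Λ₀, ∀ y' ∈ P.Λ₀, ∀ i, y i - y' i + ⌊R⌋₊ < P.a)
    {X : Finset (Site d)} (hX : ∀ p ∈ X, ∀ p' ∈ X, ∀ i, p i - p' i ≤ ⌊R⌋₊)
    {r : Fin d → ZMod P.a} {x x' : Site d} (hx : x ∈ P.touch r X) (hx' : x' ∈ P.touch r X) : x = x' := by
  rw [mem_touch] at hx hx'
  obtain ⟨hs, y, hy, hyx⟩ := hx
  obtain ⟨hs', y', hy', hyx'⟩ := hx'
  funext i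
  have hdvd : (P.a : ℤ) ∣ x' i - x i :=
    (ZMod.intCast_eq_intCast_iff_dvd_sub (x i) (x' i) P.a).1 ((hs i).trans (hs' i).symm)
  have h1 := hX _ hyx _ hyx' i
  have h2 := hX _ hyx' _ hyx i
  have h3 := hsp _ hy' _ hy i
  have h4 := hsp _ hy _ hy' i
  simp only [Pi.add_apply] at h1 h2
  have hlt : |x' i - x i| < P.a := by
    rw [abs_lt]; constructor <;> linarith
  by_contra hxi
  have hne' : x' i - x i ≠ 0 := sub_ne_zero.2 (Ne.symm hxi)
  have hle := Int.le_of_dvd (abs_pos.2 hne') ((dvd_abs _ _).2 hdvd)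
  exact absurd (lt_of_le_of_lt hle hlt) (lt_irrefl _)

/-! ### §3. The contribution of one translate -/

/-- **The energy of the term `Φ X` after the Kraus perturbation at the translate `x + Λ₀`**, computed
in the region `X ∪ (x + Λ₀)`: `ω(𝓔_x(Φ X))`. [cite: BratteliKishimotoRobinson1978, Thm. 2 (proof)] -/
def krausTerm (Ψ : FermionInteraction d) (ω : InfVolFermionState d) (x : Site d) (X : Finset (Site d)) : ℂ :=
  ω.expect (X ∪ shiftSet x P.Λ₀)
    (krausMap (P.transEmb x Finset.subset_union_right) P.V
      (fermionEmbed (PolySite.incl Finset.subset_union_left) (Ψ.Φ X)))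

/-- The **energy change** `δ_x(X) = ω(𝓔_x(Φ X)) − ω(Φ X)` of the term `Φ X` under the perturbation at
`x + Λ₀`. [cite: BratteliKishimotoRobinson1978, Thm. 2 (proof)] -/
def delta (Ψ : FermionInteraction d) (ω : InfVolFermionState d) (x : Site d) (X : Finset (Site d)) : ℂ :=
  P.krausTerm Ψ ω x X - ω.expect X (Ψ.Φ X)

/-- The energy change vanishes on regions carrying no term. [cite: BratteliKishimotoRobinson1978, Thm. 2 (proof)] -/
theorem delta_eq_zero_of_apply_eq_zero {Ψ : FermionInteraction d} (ω : InfVolFermionState d) (x : Site d)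
    {X : Finset (Site d)} (hX : Ψ.Φ X = 0) : P.delta Ψ ω x X = 0 := by
  rw [delta, krausTerm, hX, map_zero, map_zero, map_zero, map_zero, sub_zero]

/-- **The sparse perturbation changes the energy of `Φ X` by the contributions of the sparse translates
meeting `X`, when at most one does**: `ω_r(Φ X) − ω(Φ X) = Σ_{x ∈ touch_r X} δ_x(X)`.
[cite: BratteliKishimotoRobinson1978, Thm. 2 (proof)] -/
theorem sparseState_expect_sub_eq_sum_delta (Ψ : FermionInteraction d) (ω : InfVolFermionState d)
    (hω : ω.IsEven) {r : Fin d → ZMod P.a} {X : Finset (Site d)}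
    (hsub : ∀ x ∈ P.touch r X, ∀ x' ∈ P.touch r X, x = x') :
    (P.sparseState r ω hω).expect X (Ψ.Φ X) - ω.expect X (Ψ.Φ X) = ∑ x ∈ P.touch r X, P.delta Ψ ω x X := by
  classical
  rw [sparseState_expect]
  rcases (P.touch r X).eq_empty_or_nonempty with h0 | ⟨x, hx⟩
  · -- no translate meets `X`: the sparse map is the identity
    have h1 : P.sparseMap r X (fermionEmbed (PolySite.incl (P.subset_hull r X)) (Ψ.Φ X)) =
        fermionEmbed (PolySite.incl (P.subset_hull r X)) (Ψ.Φ X) := by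
      unfold sparseMap
      rw [Finset.noncommProd_congr h0 (fun _ _ => rfl), Finset.noncommProd_empty, Module.End.one_apply]
    rw [h1, ω.compatible, sub_self, h0, Finset.sum_empty]
  · -- exactly one translate `x` meets `X`
    have h1 : P.touch r X = {x} := Finset.eq_singleton_iff_unique_mem.2 ⟨hx, fun x' hx' => hsub x' hx' x hx⟩
    have hxh : shiftSet x P.Λ₀ ⊆ P.hull r X := P.shiftSet_subset_hull hx
    have h2 : P.sparseMap r X (fermionEmbed (PolySite.incl (P.subset_hull r X)) (Ψ.Φ X)) =
        P.localMap (P.hull r X) x (fermionEmbed (PolySite.incl (P.subset_hull r X)) (Ψ.Φ X)) := by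
      unfold sparseMap
      rw [Finset.noncommProd_congr h1 (fun _ _ => rfl), Finset.noncommProd_singleton]
    rw [h2, h1, Finset.sum_singleton, delta, krausTerm, P.localMap_of_subset hxh]
    congr 1
    -- move the Kraus term from `X ∪ (x + Λ₀)` into the hull
    have hsub' : X ∪ shiftSet x P.Λ₀ ⊆ P.hull r X := Finset.union_subset (P.subset_hull r X) hxh
    rw [← ω.compatible hsub', fermionEmbed_krausMap, fermionEmbed_fermionEmbed, PolySite.incl_trans]
    rfl

/-! ### §4. Translation invariance reduces every contribution to the one at `Λ₀` -/

/-- **The energy change of `Φ Z` under the perturbation AT `Λ₀`** (computed in `Z ∪ Λ₀`):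
`δ₀(Z) = ω(𝓔(Φ Z)) − ω(Φ Z)`. [cite: BratteliKishimotoRobinson1978, Thm. 2 (proof)] -/
def delta0 (Ψ : FermionInteraction d) (ω : InfVolFermionState d) (Z : Finset (Site d)) : ℂ :=
  ω.expect (Z ∪ P.Λ₀)
      (krausMap (PolySite.incl Finset.subset_union_right) P.V
        (fermionEmbed (PolySite.incl Finset.subset_union_left) (Ψ.Φ Z))) -
    ω.expect Z (Ψ.Φ Z)

/-- `δ₀` vanishes on regions carrying no term. [cite: BratteliKishimotoRobinson1978, Thm. 2 (proof)] -/
theorem delta0_eq_zero_of_apply_eq_zero {Ψ : FermionInteraction d} (ω : InfVolFermionState d)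
    {Z : Finset (Site d)} (hZ : Ψ.Φ Z = 0) : P.delta0 Ψ ω Z = 0 := by
  rw [delta0, hZ, map_zero, map_zero, map_zero, map_zero, sub_zero]

/-- `δ₀` vanishes on regions disjoint from `Λ₀` (the Kraus map fixes the even term `Φ Z`).
[cite: BratteliRobinsonII1997, §5.2.2 (even elements of disjoint regions commute)] -/
theorem delta0_eq_zero_of_disjoint {Ψ : FermionInteraction d} (hΨE : Ψ.IsEven) (ω : InfVolFermionState d)
    {Z : Finset (Site d)} (hZ : Disjoint Z P.Λ₀) : P.delta0 Ψ ω Z = 0 := by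
  rw [delta0, krausMap_fermionEmbed_of_disjoint_of_even _ _ ?_ P.sum_conjTranspose_mul (hΨE Z),
    ω.compatible, sub_self]
  exact disjoint_map_of_sites _ _ (fun p => PolySite.ofLex_mem p) (fun p => PolySite.ofLex_mem p) hZ.symm

/-- **Translation invariance of `ω` and `Φ` moves every contribution to `Λ₀`**:
`δ_x(Z + x) = δ₀(Z)`. [cite: BratteliKishimotoRobinson1978, Thm. 2 (ℤ^ν-invariant Φ and ω)] -/
theorem delta_shiftSet {Ψ : FermionInteraction d} (hΨT : Ψ.IsTranslationInvariant) {ω : InfVolFermionState d}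
    (hωT : ω.IsTranslationInvariant) (x : Site d) (Z : Finset (Site d)) :
    P.delta Ψ ω x (shiftSet x Z) = P.delta0 Ψ ω Z := by
  unfold delta delta0 krausTerm
  rw [hΨT x Z]
  congr 1
  · have hU : shiftSet x (Z ∪ P.Λ₀) ⊆ shiftSet x Z ∪ shiftSet x P.Λ₀ :=
      (Finset.map_union (f := (Site.shift x).toEmbedding) Z P.Λ₀).subset
    conv_rhs => rw [← hωT x, InfVolFermionState.shift_expect, ← ω.compatible hU, fermionEmbed_fermionEmbed,
      fermionEmbed_krausMap, fermionEmbed_fermionEmbed]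
    rw [fermionEmbed_fermionEmbed]
    rfl
  · conv_rhs => rw [← hωT x, InfVolFermionState.shift_expect]

/-- `δ_x(X) = δ₀(X − x)`. [cite: BratteliKishimotoRobinson1978, Thm. 2 (ℤ^ν-invariant Φ and ω)] -/
theorem delta_eq_delta0 {Ψ : FermionInteraction d} (hΨT : Ψ.IsTranslationInvariant) {ω : InfVolFermionState d}
    (hωT : ω.IsTranslationInvariant) (x : Site d) (X : Finset (Site d)) :
    P.delta Ψ ω x X = P.delta0 Ψ ω (shiftSet (-x) X) := by
  have h := P.delta_shiftSet hΨT hωT x (shiftSet (-x) X)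
  rwa [IsSmallTIActivity.shiftSet_shiftSet, neg_add_cancel, IsSmallTIActivity.shiftSet_zero] at h

/-! ### §5. Double counting over rooted regions -/

/-- `(Z + (-x)) + x = Z`. [cite: BratteliRobinsonII1997, §6.2.1 (lattice translations)] -/
theorem shiftSet_shiftSet_neg (x : Site d) (X : Finset (Site d)) : shiftSet x (shiftSet (-x) X) = X := by
  rw [IsSmallTIActivity.shiftSet_shiftSet, neg_add_cancel, IsSmallTIActivity.shiftSet_zero]

/-- `(Z + x) + (-x) = Z`. [cite: BratteliRobinsonII1997, §6.2.1 (lattice translations)] -/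
theorem shiftSet_neg_shiftSet (x : Site d) (X : Finset (Site d)) : shiftSet (-x) (shiftSet x X) = X := by
  rw [IsSmallTIActivity.shiftSet_shiftSet, add_neg_cancel, IsSmallTIActivity.shiftSet_zero]

/-- A translate meeting a region inside the `R`-ball of the origin, translated back, lies in the double
`R`-neighbourhood `U = (Λ₀)_{R,R}` of `Λ₀`. [cite: BratteliRobinsonII1997, §6.2.1 (finite range)] -/
theorem shiftSet_neg_subset_U {R : ℝ} {X : Finset (Site d)} (hX : X ⊆ thicken ({0} : Finset (Site d)) R)
    {x : Site d} (hx : x ∈ P.allTouch X) :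
    shiftSet (-x) X ⊆ thicken (thicken P.Λ₀ R) R := by
  obtain ⟨q, hq, hqx⟩ := P.mem_allTouch.1 hx
  intro z hz
  rw [mem_shiftSet, sub_neg_eq_add] at hz
  -- `q + x = 0 + w₀` and `z + x = 0 + w` with `w₀, w ∈ box ⌊R⌋`
  obtain ⟨s₀, hs₀, w₀, hw₀, h₀⟩ := mem_thicken_iff.1 (hX hqx)
  obtain ⟨s, hs, w, hw, h⟩ := mem_thicken_iff.1 (hX hz)
  rw [Finset.mem_singleton] at hs₀ hs
  subst hs₀; subst hs
  rw [zero_add] at h₀ h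
  rw [mem_thicken_iff]
  refine ⟨q + -w₀, mem_thicken_iff.2 ⟨q, hq, -w₀, ?_, rfl⟩, w, hw, ?_⟩
  · rw [mem_box] at hw₀ ⊢
    intro i
    have := hw₀ i
    simp only [Pi.neg_apply]
    omega
  · -- `q + (-w₀) + w = z` since `w₀ = q + x`, `w = z + x`
    rw [h₀, h]; abel

/-- **Double counting**: the contributions `|X|⁻¹ δ₀(X − x)` summed over the regions `X ∋ 0` inside the
`R`-ball and the translates `x` meeting them equal the contributions `|Z|⁻¹ δ₀(Z)` summed over the
rooted regions `(Z, y)`, `y ∈ Z`, with `Z ⊆ U` meeting `Λ₀` and `Z − y` inside the `R`-ball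
(`(X, x) ↦ (X − x, −x)`). [cite: Ruelle1969GroundState, §2 eq. (4) (the weights `N(X)⁻¹`)] -/
theorem sum_sum_allTouch_eq_sum_rooted (Ψ : FermionInteraction d) (ω : InfVolFermionState d) (R : ℝ) :
    ∑ X ∈ (thicken ({0} : Finset (Site d)) R).powerset with (0 : Site d) ∈ X,
        ∑ x ∈ P.allTouch X, ((X.card : ℂ)⁻¹) * P.delta0 Ψ ω (shiftSet (-x) X) =
      ∑ Z ∈ (thicken (thicken P.Λ₀ R) R).powerset with ¬ Disjoint Z P.Λ₀,
        ∑ y ∈ Z with shiftSet (-y) Z ⊆ thicken ({0} : Finset (Site d)) R,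
          ((Z.card : ℂ)⁻¹) * P.delta0 Ψ ω Z := by
  classical
  rw [Finset.sum_sigma', Finset.sum_sigma']
  refine Finset.sum_nbij' (fun p => ⟨shiftSet (-p.2) p.1, -p.2⟩) (fun q => ⟨shiftSet (-q.2) q.1, -q.2⟩)
    ?_ ?_ ?_ ?_ ?_
  · -- the map lands in the rooted regions
    rintro ⟨X, x⟩ hp
    rw [Finset.mem_sigma, Finset.mem_filter, Finset.mem_powerset] at hp
    obtain ⟨⟨hXR, h0⟩, hx⟩ := hp
    obtain ⟨q, hq, hqx⟩ := P.mem_allTouch.1 hx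
    rw [Finset.mem_sigma, Finset.mem_filter, Finset.mem_powerset, Finset.mem_filter]
    refine ⟨⟨P.shiftSet_neg_subset_U hXR hx, ?_⟩, ?_, ?_⟩
    · rw [Finset.not_disjoint_iff]
      exact ⟨q, by rw [mem_shiftSet, sub_neg_eq_add]; exact hqx, hq⟩
    · rw [mem_shiftSet, sub_neg_eq_add, neg_add_cancel]; exact h0
    · rw [neg_neg, shiftSet_shiftSet_neg]; exact hXR
  · -- the inverse map lands in the pointed regions inside the ball
    rintro ⟨Z, y⟩ hq
    rw [Finset.mem_sigma, Finset.mem_filter, Finset.mem_powerset, Finset.mem_filter] at hq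
    obtain ⟨⟨-, hZ⟩, hy, hyR⟩ := hq
    obtain ⟨q, hqZ, hq⟩ := Finset.not_disjoint_iff.1 hZ
    rw [Finset.mem_sigma, Finset.mem_filter, Finset.mem_powerset]
    refine ⟨⟨hyR, ?_⟩, ?_⟩
    · rw [mem_shiftSet, sub_neg_eq_add, zero_add]; exact hy
    · rw [P.mem_allTouch]
      exact ⟨q, hq, by rw [mem_shiftSet, sub_neg_eq_add, add_assoc, neg_add_cancel, add_zero]; exact hqZ⟩
  · rintro ⟨X, x⟩ _
    simp only [neg_neg, shiftSet_shiftSet_neg]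
  · rintro ⟨Z, y⟩ _
    simp only [neg_neg, shiftSet_shiftSet_neg]
  · rintro ⟨X, x⟩ _
    simp only [card_shiftSet]

/-- **For a rooted region every root is admissible or the contribution vanishes**:
`Σ_{y ∈ Z, Z−y ⊆ B_R} |Z|⁻¹ δ₀(Z) = δ₀(Z)` for `Z` meeting `Λ₀` (if `Φ Z ≠ 0` every `y ∈ Z` is admissible
by finite range; if `Φ Z = 0` both sides vanish). [cite: BratteliRobinsonII1997, §6.2.1 (finite range)] -/
theorem sum_roots_eq {Ψ : FermionInteraction d} {R : ℝ} (hR : Ψ.HasFiniteRange R) (ω : InfVolFermionState d)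
    {Z : Finset (Site d)} (hZ : ¬ Disjoint Z P.Λ₀) :
    ∑ y ∈ Z with shiftSet (-y) Z ⊆ thicken ({0} : Finset (Site d)) R, ((Z.card : ℂ)⁻¹) * P.delta0 Ψ ω Z =
      P.delta0 Ψ ω Z := by
  by_cases h0 : Ψ.Φ Z = 0
  · rw [P.delta0_eq_zero_of_apply_eq_zero ω h0, mul_zero, Finset.sum_const_zero]
  · have hfilter : (Z.filter fun y => shiftSet (-y) Z ⊆ thicken ({0} : Finset (Site d)) R) = Z :=
      Finset.filter_true_of_mem fun y hy => hR.shiftSet_neg_subset_thicken_zero h0 hy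
    rw [hfilter, Finset.sum_const, nsmul_eq_mul, ← mul_assoc]
    have hne : Z.Nonempty := by
      obtain ⟨q, hq, -⟩ := Finset.not_disjoint_iff.1 hZ
      exact ⟨q, hq⟩
    have hc : (Z.card : ℂ) ≠ 0 := Nat.cast_ne_zero.2 (Finset.card_pos.2 hne).ne'
    rw [mul_inv_cancel₀ hc, one_mul]

/-- **The contributions at `Λ₀` sum to the energy change of the local Hamiltonian**:
`Σ_{Z ⊆ U} δ₀(Z) = ω(𝓔(H_U)) − ω(H_U)`. [cite: BratteliKishimotoRobinson1978, Thm. 2 (proof) and §3 (local Hamiltonians)] -/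
theorem sum_delta0_powerset (Ψ : FermionInteraction d) (ω : InfVolFermionState d) {U : Finset (Site d)}
    (hU : P.Λ₀ ⊆ U) :
    ∑ Z ∈ U.powerset, P.delta0 Ψ ω Z =
      ω.expect U (krausMap (PolySite.incl hU) P.V (Ψ.localHamiltonian U)) - ω.expect U (Ψ.localHamiltonian U) := by
  rw [FermionInteraction.localHamiltonian_eq_sum, map_sum, map_sum, map_sum, ← Finset.sum_sub_distrib]
  refine Finset.sum_congr rfl fun Z hZ => ?_
  rw [Finset.mem_powerset] at hZ
  rw [dif_pos hZ, delta0, ω.compatible hZ]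
  congr 1
  have hZU : Z ∪ P.Λ₀ ⊆ U := Finset.union_subset hZ hU
  rw [← ω.compatible hZU, fermionEmbed_krausMap, fermionEmbed_fermionEmbed, PolySite.incl_trans, PolySite.incl_trans]

/-! ### §6. The mean energy of the cell average -/

/-- The expectation of the mean-energy observable is the weighted sum of the energies of the terms at the
origin: `σ(E_Φ) = Σ_{X ∋ 0} |X|⁻¹ σ(Φ X)`. [cite: Ruelle1969GroundState, §2 eq. (4)] -/
theorem expect_meanEnergyObs (Ψ : FermionInteraction d) (R : ℝ) (σ : InfVolFermionState d) :
    σ.expect _ (Ψ.meanEnergyObs R) =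
      ∑ X ∈ (thicken ({0} : Finset (Site d)) R).powerset with (0 : Site d) ∈ X,
        ((X.card : ℂ)⁻¹) * σ.expect X (Ψ.Φ X) := by
  rw [FermionInteraction.meanEnergyObs_eq_sum, map_sum]
  refine Finset.sum_congr rfl fun X hX => ?_
  rw [Finset.mem_filter, Finset.mem_powerset] at hX
  rw [dif_pos hX.1, map_smul, σ.compatible hX.1, smul_eq_mul]

/-- **The energy shift of ONE sparse perturbation, term by term**: for a region `X` of range `≤ ⌊R⌋` (or
carrying no term), `ω_r(Φ X) − ω(Φ X) = Σ_{x ∈ touch_r X} δ_x(X)`.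
[cite: BratteliKishimotoRobinson1978, Thm. 2 (proof)] -/
theorem sparseState_expect_sub_eq_sum_delta' {Ψ : FermionInteraction d} {R : ℝ} (hR : Ψ.HasFiniteRange R)
    (hsp : ∀ y ∈ P.Λ₀, ∀ y' ∈ P.Λ₀, ∀ i, y i - y' i + ⌊R⌋₊ < P.a)
    (ω : InfVolFermionState d) (hω : ω.IsEven) (r : Fin d → ZMod P.a) (X : Finset (Site d)) :
    (P.sparseState r ω hω).expect X (Ψ.Φ X) - ω.expect X (Ψ.Φ X) = ∑ x ∈ P.touch r X, P.delta Ψ ω x X := by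
  by_cases h0 : Ψ.Φ X = 0
  · rw [h0, map_zero, map_zero, sub_zero]
    exact (Finset.sum_eq_zero fun x _ => P.delta_eq_zero_of_apply_eq_zero ω x h0).symm
  · exact P.sparseState_expect_sub_eq_sum_delta Ψ ω hω
      (fun x hx x' hx' => P.touch_subsingleton hsp (fun p hp p' hp' i => hR.sub_le_floor h0 hp hp' i) hx hx')

/-- **The mean energy of the cell-averaged sparse Kraus perturbation.** For an even, translation-invariant
interaction `Φ` of finite range `R`, a translation-invariant state `ω` (even: `hω`), and a Kraus pattern
`P = (Λ₀, V, a)` with spacing `a > (extent of Λ₀) + ⌊R⌋`: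

  `e_Φ(cellState ω) = e_Φ(ω) + (a^d)⁻¹ · Re[ ω(𝓔(H_U)) − ω(H_U) ]`,  `U = thicken (thicken Λ₀ R) R`,

`𝓔 = Σ_k V_k⋆ (·) V_k` placed at `Λ₀ ⊆ U`, `H_U` the local Hamiltonian of `U`. (Perturbing at density
`a^{-d}` changes the mean energy by `a^{-d}` times the energy change of one local perturbation.) The energy
bookkeeping behind Ruelle 1969 Thm. 2 / Bratteli–Kishimoto–Robinson 1978 Thm. 2 (`2 ⇒ 1`), done with the
finite-range structure instead of tangent functionals. [cite: BratteliKishimotoRobinson1978, Thm. 2; Ruelle1969GroundState Thm. 2] -/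
theorem meanEnergy_cellState_eq [NeZero P.a] {Ψ : FermionInteraction d} {R : ℝ} (hR : Ψ.HasFiniteRange R)
    (hΨT : Ψ.IsTranslationInvariant) (hΨE : Ψ.IsEven)
    (hsp : ∀ y ∈ P.Λ₀, ∀ y' ∈ P.Λ₀, ∀ i, y i - y' i + ⌊R⌋₊ < P.a)
    (ω : InfVolFermionState d) (hω : ω.IsEven) (hωT : ω.IsTranslationInvariant) :
    (P.cellState ω hω).meanEnergy Ψ R =
      ω.meanEnergy Ψ R + ((P.a : ℝ) ^ d)⁻¹ *
        (ω.expect (thicken (thicken P.Λ₀ R) R)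
            (krausMap (PolySite.incl ((subset_thicken P.Λ₀ R).trans (subset_thicken _ R))) P.V
              (Ψ.localHamiltonian (thicken (thicken P.Λ₀ R) R))) -
          ω.expect (thicken (thicken P.Λ₀ R) R) (Ψ.localHamiltonian (thicken (thicken P.Λ₀ R) R))).re := by
  classical
  set U := thicken (thicken P.Λ₀ R) R with hUdef
  have hΛU : P.Λ₀ ⊆ U := (subset_thicken P.Λ₀ R).trans (subset_thicken _ R)
  -- Step 1: the per-class energy shifts, summed over the classes
  have hN : (Fintype.card (Fin d → ZMod P.a) : ℝ) = (P.a : ℝ) ^ d := by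
    rw [Fintype.card_fun, ZMod.card, Fintype.card_fin]; push_cast; rfl
  have hclass : ∀ r : Fin d → ZMod P.a,
      (P.sparseState r ω hω).meanEnergy Ψ R - ω.meanEnergy Ψ R =
        (∑ X ∈ (thicken ({0} : Finset (Site d)) R).powerset with (0 : Site d) ∈ X,
          ((X.card : ℂ)⁻¹) * ∑ x ∈ P.touch r X, P.delta Ψ ω x X).re := by
    intro r
    rw [InfVolFermionState.meanEnergy, InfVolFermionState.meanEnergy, ← Complex.sub_re, expect_meanEnergyObs,
      expect_meanEnergyObs, ← Finset.sum_sub_distrib]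
    congr 1
    refine Finset.sum_congr rfl fun X _ => ?_
    rw [← mul_sub, P.sparseState_expect_sub_eq_sum_delta' hR hsp ω hω r X]
  -- Step 2: sum over the classes and the double counting
  have htotal : ∑ r : Fin d → ZMod P.a,
      ∑ X ∈ (thicken ({0} : Finset (Site d)) R).powerset with (0 : Site d) ∈ X,
        ((X.card : ℂ)⁻¹) * ∑ x ∈ P.touch r X, P.delta Ψ ω x X =
      ω.expect U (krausMap (PolySite.incl hΛU) P.V (Ψ.localHamiltonian U)) - ω.expect U (Ψ.localHamiltonian U) := by
    rw [Finset.sum_comm]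
    have h1 : ∀ X ∈ (thicken ({0} : Finset (Site d)) R).powerset.filter (fun X => (0 : Site d) ∈ X),
        ∑ r : Fin d → ZMod P.a, ((X.card : ℂ)⁻¹) * ∑ x ∈ P.touch r X, P.delta Ψ ω x X =
          ∑ x ∈ P.allTouch X, ((X.card : ℂ)⁻¹) * P.delta0 Ψ ω (shiftSet (-x) X) := by
      intro X _
      rw [← Finset.mul_sum, P.sum_sum_touch_eq_sum_allTouch X, Finset.mul_sum]
      exact Finset.sum_congr rfl fun x _ => by rw [P.delta_eq_delta0 hΨT hωT x X]
    rw [Finset.sum_congr rfl h1, P.sum_sum_allTouch_eq_sum_rooted Ψ ω R,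
      Finset.sum_congr rfl (fun Z hZ => P.sum_roots_eq hR ω (Finset.mem_filter.1 hZ).2),
      Finset.sum_filter_of_ne (fun Z hZ hne => ?_), P.sum_delta0_powerset Ψ ω hΛU]
    -- regions disjoint from `Λ₀` do not contribute
    intro hdis
    exact hne (P.delta0_eq_zero_of_disjoint hΨE ω hdis)
  -- Step 3: assemble
  rw [P.meanEnergy_cellState Ψ R ω hω, hN]
  have hsum : ∑ r : Fin d → ZMod P.a, (P.sparseState r ω hω).meanEnergy Ψ R =
      (Fintype.card (Fin d → ZMod P.a) : ℝ) * ω.meanEnergy Ψ R +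
        (ω.expect U (krausMap (PolySite.incl hΛU) P.V (Ψ.localHamiltonian U)) -
          ω.expect U (Ψ.localHamiltonian U)).re := by
    have : ∀ r : Fin d → ZMod P.a, (P.sparseState r ω hω).meanEnergy Ψ R =
        ω.meanEnergy Ψ R + (∑ X ∈ (thicken ({0} : Finset (Site d)) R).powerset with (0 : Site d) ∈ X,
          ((X.card : ℂ)⁻¹) * ∑ x ∈ P.touch r X, P.delta Ψ ω x X).re := fun r => by
      rw [← hclass r]; ring
    rw [Finset.sum_congr rfl (fun r _ => this r), Finset.sum_add_distrib, Finset.sum_const, Finset.card_univ,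
      nsmul_eq_mul, ← Complex.re_sum, htotal]
  rw [hsum, hN]
  have hpos : (P.a : ℝ) ^ d ≠ 0 := pow_ne_zero _ (Nat.cast_ne_zero.2 (NeZero.ne P.a))
  field_simp
  ring

end KrausPattern

end Literature.MathematicalPhysics.QuantumLattice

end
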